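import Summits.Ventures.LatticeQCDFlow.Scaling.LadderRobinModeHotRate
import Summits.Ventures.LatticeQCDFlow.Scaling.HomLadderMixingCeiling

/-!
HONEST FRAMING: exact (Metropolis-corrected) sampling algorithms for lattice gauge theory; figures
of merit are autocorrelation/cost numbers at stated couplings and volumes; no continuum-physics
claim.

# HomLadderTwoChannelLaw — THE HOMOGENEOUS LADDER IS `Θ(max{K³/t, K/h}·log K)` TWO-SIDED IN `K`, `t` AND THE HOT RATE `h = (1−t)w_0`, INCLUDING THE LOGARITHM:
# **`(max{K(2K+1)²/(π²t), 2(K+1)/(3πh)} − 1)·(½·log(K+1) − log(24√5)) ≤ t_mix(1/4) ≤ ⌈max{K(2K+1)²/t, π²(K+1)/(2√2h)}·log(4√2K(K+1)(2K+1)/t)⌉`** (lean-2 GEN-47, ours)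

Venture-side (OURS).  Cell `lqcd-flow` (pub-lqcd), unit `pub-lqcd-lean-2-g47`, 2026-08-31.  Chapter AG, file 12 — the law in both channels.  File 3's floor is the swap channel (uniform in `h`),
file 9's ceiling is `max{swap, hot}`; file 11 (`2(K+1)ρ ≤ 3πh`) puts the hot channel on the floor side too, WITH the logarithm and law-free: from the constant cold start `(u,…,u)` every one of
the `K+1` contents must be replaced through the single hot seat, and Wilson's statistic sees the last of them.  Setting of files 2–3 (weighted homogeneous ladder `t·ptBareSwap ν^{⊗} +
(1−t)·prodKernel w M`, exact hot sampler, idle cold kernels, `0 < t < 1`, `w_0 > 0`, one positive law `ν` with some `ν(u) ≤ ½`); `K ≥ 4` makes both floor coefficients non-negative for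
every `h ≤ 1`.  Hypothesis-equation `hP`; no definitions.

* **`homLadder_mixingTime_ge_hot`** (`(2(K+1)/(3π(1−t)w_0) − 1)·(½·log(K+1) − log(24√5)) ≤ t_mix(1/4)`, `K ≥ 4`), **`homLadder_mixingTime_ge_max`** (the two floors in one),
  **`homLadder_mixingTime_two_sided_channels`** (with file 9's ceiling).

Reading (no numerics implied): for the replica-exchange ladder with perfect adjacent transports the number of steps to forget a cold start is, up to the constants `1/(2π²)·` ∕ `2/(3π)·` below
and `1·` ∕ `π²/(2√2)·` (times `6`, from `log(K³)` against `½log K`) above, THE LARGER OF the diffusive transport time `K³/t` and the refresh budget `K/h`, TIMES `log K` — for every content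
law, every swap probability and every allocation of the updates.  NOT CLAIMED: the cutoff window; imperfect transports.  Literature grade (cell rule): OWN; nothing cited; no new bib keys.
-/

noncomputable section

open Finset Function Real
open Literature.Probability.MarkovChains

namespace Summit.Ventures.LatticeQCDFlow.Scaling

variable {S : Type*} [Fintype S] [DecidableEq S] {K : ℕ} {ν : S → ℝ} {M : Fin (K + 1) → S → S → ℝ} {w : Fin (K + 1) → ℝ} {t : ℝ}
  {P : (Fin (K + 1) → S) → (Fin (K + 1) → S) → ℝ}

/-- **THE HOT-CHANNEL FLOOR, LAW-FREE WITH THE LOGARITHM:** `K ≥ 4`, `0 < t < 1`, `w` a probability vector with `w_0 > 0`, one positive law `ν` with some `ν(u) ≤ ½`, exact hot sampler, idle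
cold kernels ⇒ **`(2(K+1)/(3π(1−t)w_0) − 1)·(½·log(K+1) − log(24√5)) ≤ t_mix(1/4)`**. [ours] -/
theorem homLadder_mixingTime_ge_hot (hK : 4 ≤ K) (hν : ∀ v, 0 < ν v) (hν1 : ∑ v, ν v = 1) (hM0 : ∀ u v, M 0 u v = ν v)
    (hidle : ∀ i : Fin K, ∀ u v, M i.succ u v = if v = u then 1 else 0) (hw0 : ∀ k, 0 ≤ w k) (hw00 : 0 < w 0) (hw1 : ∑ k, w k = 1)
    (ht0 : 0 < t) (ht1 : t < 1)
    (hP : ∀ x y, P x y = t * ptBareSwap (fun _ : Fin (K + 1) => ν) x y + (1 - t) * prodKernel w M x y) (u : S) (hu : ν u ≤ 1 / 2) :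
    (2 * ((K : ℝ) + 1) / (3 * π * ((1 - t) * w 0)) - 1) * (Real.log ((K : ℝ) + 1) / 2 - Real.log (24 * Real.sqrt 5))
      ≤ (mixingTime P (tensorFun (fun _ : Fin (K + 1) => ν)) (1 / 4) : ℝ) := by
  have hK1 : 1 ≤ K := by omega
  have hK4 : (4 : ℝ) ≤ K := by exact_mod_cast hK
  have hh0 : 0 < (1 - t) * w 0 := mul_pos (by linarith) hw00
  have hw01 : w 0 ≤ 1 := by
    calc w 0 ≤ ∑ k, w k := Finset.single_le_sum (fun k _ => hw0 k) (mem_univ 0)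
      _ = 1 := hw1
  have hh1 : (1 - t) * w 0 ≤ 1 := by nlinarith
  obtain ⟨θ, hθ0, hθ1, hrobin⟩ := robinMode_exists (t := t) (h := (1 - t) * w 0) hK1 ht0 hh0
  set ρ : ℝ := 2 * t / K * (1 - Real.cos θ) with hρ
  set c : ℕ → ℝ := fun n => Real.cos (θ * ((K : ℝ) + 1 / 2 - n)) with hc_def
  have hc : ∀ n : ℕ, c n = Real.cos (θ * ((K : ℝ) + 1 / 2 - n)) := fun n => rfl
  have hmode := homLadder_mode_mixingTime_ge hK1 hν hν1 hM0 hidle hw0 hw00 hw1 ht0 ht1 hP u hu hθ0 hθ1 hrobin hρ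
  have hρ0 := robinMode_rho_pos hK1 ht0 hθ0 hθ1 hρ
  have hinv := robinMode_inv_rho_ge_hot hK1 ht0 hh0 hθ0 hθ1 hc hρ hrobin
  have hlog : Real.log (Real.sqrt ((K : ℝ) + 1) / (24 * Real.sqrt 5)) = Real.log ((K : ℝ) + 1) / 2 - Real.log (24 * Real.sqrt 5) := by
    have h5 : 0 < Real.sqrt 5 := Real.sqrt_pos.mpr (by norm_num)
    rw [Real.log_div (Real.sqrt_pos.mpr (by positivity)).ne' (by positivity), Real.log_sqrt (by positivity)]
  rw [← hlog]
  have hcoef : 2 * ((K : ℝ) + 1) / (3 * π * ((1 - t) * w 0)) - 1 ≤ (1 - ρ) / ρ := by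
    have h3 : (1 - ρ) / ρ = 1 / ρ - 1 := by field_simp
    rw [h3]; linarith
  have hcoef0 : 0 ≤ 2 * ((K : ℝ) + 1) / (3 * π * ((1 - t) * w 0)) - 1 := by
    rw [sub_nonneg, le_div_iff₀ (by positivity)]
    nlinarith [Real.pi_lt_d2, Real.pi_pos]
  by_cases hB : 0 ≤ Real.log (Real.sqrt ((K : ℝ) + 1) / (24 * Real.sqrt 5))
  · exact le_trans (mul_le_mul_of_nonneg_right hcoef hB) hmode
  · push Not at hB
    exact le_trans (mul_nonpos_of_nonneg_of_nonpos hcoef0 hB.le) (Nat.cast_nonneg _)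

/-- **THE TWO FLOORS IN ONE: `(max{K(2K+1)²/(π²t), 2(K+1)/(3π(1−t)w_0)} − 1)·(½·log(K+1) − log(24√5)) ≤ t_mix(1/4)`** (`K ≥ 4`). [ours] -/
theorem homLadder_mixingTime_ge_max (hK : 4 ≤ K) (hν : ∀ v, 0 < ν v) (hν1 : ∑ v, ν v = 1) (hM0 : ∀ u v, M 0 u v = ν v)
    (hidle : ∀ i : Fin K, ∀ u v, M i.succ u v = if v = u then 1 else 0) (hw0 : ∀ k, 0 ≤ w k) (hw00 : 0 < w 0) (hw1 : ∑ k, w k = 1)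
    (ht0 : 0 < t) (ht1 : t < 1)
    (hP : ∀ x y, P x y = t * ptBareSwap (fun _ : Fin (K + 1) => ν) x y + (1 - t) * prodKernel w M x y) (u : S) (hu : ν u ≤ 1 / 2) :
    (max ((K : ℝ) * (2 * K + 1) ^ 2 / (π ^ 2 * t)) (2 * ((K : ℝ) + 1) / (3 * π * ((1 - t) * w 0))) - 1)
        * (Real.log ((K : ℝ) + 1) / 2 - Real.log (24 * Real.sqrt 5))
      ≤ (mixingTime P (tensorFun (fun _ : Fin (K + 1) => ν)) (1 / 4) : ℝ) := by
  have h1 := homLadder_mixingTime_ge (by omega) hν hν1 hM0 hidle hw0 hw00 hw1 ht0 ht1 hP u hu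
  have h2 := homLadder_mixingTime_ge_hot hK hν hν1 hM0 hidle hw0 hw00 hw1 ht0 ht1 hP u hu
  rcases le_total ((K : ℝ) * (2 * K + 1) ^ 2 / (π ^ 2 * t)) (2 * ((K : ℝ) + 1) / (3 * π * ((1 - t) * w 0))) with h12 | h12
  · rw [max_eq_right h12]; exact h2
  · rw [max_eq_left h12]; exact h1

/-- **THE HOMOGENEOUS LADDER IS `Θ(max{K³/t, K/h}·log K)`, BOTH SIDES IN ONE STATEMENT** (`K ≥ 4`, `0 < t < 1`, `w_0 > 0`, `h = (1−t)w_0`, one positive law `ν` with some `ν(u) ≤ ½`, exact hot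
sampler, idle cold kernels):
**`(max{K(2K+1)²/(π²t), 2(K+1)/(3πh)} − 1)·(½·log(K+1) − log(24√5)) ≤ t_mix(1/4) ≤ ⌈max{K(2K+1)²/t, π²(K+1)/(2√2h)}·log(4√2K(K+1)(2K+1)/t)⌉`**. [ours] -/
theorem homLadder_mixingTime_two_sided_channels (hK : 4 ≤ K) (hν : ∀ v, 0 < ν v) (hν1 : ∑ v, ν v = 1) (hM0 : ∀ u v, M 0 u v = ν v)
    (hidle : ∀ i : Fin K, ∀ u v, M i.succ u v = if v = u then 1 else 0) (hw0 : ∀ k, 0 ≤ w k) (hw00 : 0 < w 0) (hw1 : ∑ k, w k = 1)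
    (ht0 : 0 < t) (ht1 : t < 1)
    (hP : ∀ x y, P x y = t * ptBareSwap (fun _ : Fin (K + 1) => ν) x y + (1 - t) * prodKernel w M x y) (u : S) (hu : ν u ≤ 1 / 2) :
    (max ((K : ℝ) * (2 * K + 1) ^ 2 / (π ^ 2 * t)) (2 * ((K : ℝ) + 1) / (3 * π * ((1 - t) * w 0))) - 1)
          * (Real.log ((K : ℝ) + 1) / 2 - Real.log (24 * Real.sqrt 5))
        ≤ (mixingTime P (tensorFun (fun _ : Fin (K + 1) => ν)) (1 / 4) : ℝ)
      ∧ mixingTime P (tensorFun (fun _ : Fin (K + 1) => ν)) (1 / 4)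
        ≤ ⌈max ((K : ℝ) * (2 * K + 1) ^ 2 / t) (π ^ 2 * ((K : ℝ) + 1) / (2 * Real.sqrt 2 * ((1 - t) * w 0)))
            * Real.log (Real.sqrt 2 * K * ((K : ℝ) + 1) * (2 * K + 1) / (t * (1 / 4)))⌉₊ :=
  ⟨homLadder_mixingTime_ge_max hK hν hν1 hM0 hidle hw0 hw00 hw1 ht0 ht1 hP u hu,
    homLadder_mixingTime_le (by omega) ht0 ht1 hν hν1 hM0 hidle hw0 hw00 hw1 hP (by norm_num)⟩

end Summit.Ventures.LatticeQCDFlow.Scaling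

end
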